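import Summits.KontsevichZagierPeriods.KontsevichZagierPeriods.Theorems.SoloInformedToricCuspCharts
import HarnessLib

/-!
# THEOREM A_k: the cube-degenerate family `(x₀ − x₁)² + x₀^k`, all `k ≥ 3`

Solo programme `solo-KontsevichZagierPeriods-informed`, session s106 (cube crux
`SoloInformedAyoubCubeResolutionCube`; second rung OUTSIDE the cube-nondegenerate class, the
first one being THEOREM CUSP `soloInformed_presentable_cusp` = the case `k = 3`).

For `k = m + 3 ≥ 3` the denominator `Q_m = (x₀ − x₁)² + x₀^{m+3}` (an `A_{k−1}` singularity at the
origin whose tangent cone is the diagonal) vanishes on `[0,1]²` only at the origin, but its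
initial form for the weight `(1,1)` is `(x₀ − x₁)²`, which vanishes on the diagonal of `(0,1]²`:
`Q_m` is cube-degenerate and none of THEOREM TOR / ND-GEN / CORNER / VERTEX applies.  ONE
diagonal blow-up (THEOREM DIAG, the two triangle charts of the square) followed by a vertex move
makes it toric for every `k` at once:

* lower chart `μ_low (v) = (v₀, v₀v₁)`: `Q_m(μ_low v) = v₀² ((1 − v₁)² + v₀^{m+1})`, pulled-back
  form `P(μ_low v) / (v₀ ((1 − v₁)² + v₀^{m+1}))`, and the vertex reflection `x₁ ↦ 1 − x₁` of
  `Q₁ = x₀ ((1 − x₁)² + x₀^{m+1})` is `x₀ (x₀^{m+1} + x₁²)` — cube-nondegenerate (LEMMA DOM): the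
  residual `A_{k−3}` point of the strict transform sits at a VERTEX of the chart square, where
  the toric resolution of THEOREM ND-GEN takes over;
* upper chart `μ_up (u) = (u₀u₁, u₁)`: `Q_m(μ_up u) = u₁² ((1 − u₀)² + u₀^{m+3} u₁^{m+1})`, and the
  vertex reflection `x₀ ↦ 1 − x₀` of `Q₂ = x₁ ((1 − x₀)² + x₀^{m+3} x₁^{m+1})` is
  `x₁ (x₀² + x₁^{m+1} (1 − x₀)^{m+3})`, cube-nondegenerate by LEMMA DOM with dominant powers
  `x₀², x₁^{m+1}` and the mixed-sign remainder `x₁^{m+1} ((1 − x₀)^{m+3} − 1)`.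

Hence **THEOREM A_k** `soloInformed_presentable_ak`: `[σ, P/((x₀ − x₁)² + x₀^{m+3})]` is
presentable (`k = 1` in the cube crux) for every `m`, every numerator `P ∈ ℚ[x₀, x₁]` and every
`(0,1)² ⊆ σ ⊆ [0,1]²` on which it is an `IntegralRep`; hypothesis-free instances are the bounded
integrands `x₀^{m+3} / Q_m` on the open square (`soloInformed_presentable_akRep`).  The case
`m = 0` is THEOREM CUSP (`soloInformed_akDen_zero`, `soloInformed_akChartDen_zero`).

References: M. Kontsevich, D. Zagier, *Periods* (2001) §1.2; A. N. Varchenko, Funct. Anal.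
Appl. 10 (1976); A. G. Kouchnirenko, Invent. Math. 32 (1976) §1; J. Ayoub, EMS Newsl. 91 (2014)
§2.2.
-/

noncomputable section

open scoped BigOperators
open MeasureTheory Set
open Literature.NumberTheory.Transcendental Literature.NumberTheory.Transcendental.KZ
open Literature.ModelTheory.ExponentialFields (IsSemialgebraic)

namespace Summit.KontsevichZagierPeriods.KontsevichZagierPeriods.Theorems

/-! ## The family and its chart denominators -/

/-- The `A`-family denominator `Q_m = (x₀ − x₁)² + x₀^{m+3}`. -/
def soloInformedAkDen (m : ℕ) : MvPolynomial (Fin 2) ℚ :=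
  (MvPolynomial.X 0 - MvPolynomial.X 1) ^ 2 + MvPolynomial.X 0 ^ (m + 3)

/-- The lower-chart denominator `Q₁ = x₀ ((1 − x₁)² + x₀^{m+1})`. -/
def soloInformedAkLowerDen (m : ℕ) : MvPolynomial (Fin 2) ℚ :=
  MvPolynomial.X 0 * ((1 - MvPolynomial.X 1) ^ 2 + MvPolynomial.X 0 ^ (m + 1))

/-- The upper-chart denominator `Q₂ = x₁ ((1 − x₀)² + x₀^{m+3} x₁^{m+1})`. -/
def soloInformedAkUpperDen (m : ℕ) : MvPolynomial (Fin 2) ℚ :=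
  MvPolynomial.X 1 *
    ((1 - MvPolynomial.X 0) ^ 2 + MvPolynomial.X 0 ^ (m + 3) * MvPolynomial.X 1 ^ (m + 1))

/-- The reflected upper-chart denominator `x₀² + x₁^{m+1} (1 − x₀)^{m+3}` (mixed signs). -/
def soloInformedAkChartDen (m : ℕ) : MvPolynomial (Fin 2) ℚ :=
  MvPolynomial.X 0 ^ 2 + MvPolynomial.X 1 ^ (m + 1) * (1 - MvPolynomial.X 0) ^ (m + 3)

/-- Its remainder `x₁^{m+1} ((1 − x₀)^{m+3} − 1)` beyond the dominant powers `x₀², x₁^{m+1}`. -/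
def soloInformedAkChartR (m : ℕ) : MvPolynomial (Fin 2) ℚ :=
  MvPolynomial.X 1 ^ (m + 1) * ((1 - MvPolynomial.X 0) ^ (m + 3) - 1)

/-- `m = 0` is the cusp denominator of THEOREM CUSP. -/
theorem soloInformed_akDen_zero : soloInformedAkDen 0 = soloInformedCuspDen := rfl

/-- `m = 0`: the reflected chart denominator is the cusp-chart denominator of LEMMA DOM. -/
theorem soloInformed_akChartDen_zero : soloInformedAkChartDen 0 = soloInformedCuspChartDen := by
  simp [soloInformedAkChartDen, soloInformedCuspChartDen]

/-- Evaluation of `Q_m`. -/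
theorem soloInformed_aeval_akDen (m : ℕ) (x : Fin 2 → ℝ) :
    MvPolynomial.aeval x (soloInformedAkDen m) = (x 0 - x 1) ^ 2 + x 0 ^ (m + 3) := by
  simp [soloInformedAkDen]

/-- Evaluation of the lower-chart denominator. -/
theorem soloInformed_aeval_akLowerDen (m : ℕ) (x : Fin 2 → ℝ) :
    MvPolynomial.aeval x (soloInformedAkLowerDen m) = x 0 * ((1 - x 1) ^ 2 + x 0 ^ (m + 1)) := by
  simp [soloInformedAkLowerDen]

/-- Evaluation of the upper-chart denominator. -/
theorem soloInformed_aeval_akUpperDen (m : ℕ) (x : Fin 2 → ℝ) :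
    MvPolynomial.aeval x (soloInformedAkUpperDen m) =
      x 1 * ((1 - x 0) ^ 2 + x 0 ^ (m + 3) * x 1 ^ (m + 1)) := by
  simp [soloInformedAkUpperDen]

/-- Evaluation of the reflected upper-chart denominator. -/
theorem soloInformed_aeval_akChartDen (m : ℕ) (x : Fin 2 → ℝ) :
    MvPolynomial.aeval x (soloInformedAkChartDen m) =
      x 0 ^ 2 + x 1 ^ (m + 1) * (1 - x 0) ^ (m + 3) := by
  simp [soloInformedAkChartDen]

/-- `Q_m` vanishes on the closed square only at the origin. [this work] -/
theorem soloInformed_aeval_akDen_eq_zero_iff (m : ℕ) (x : Fin 2 → ℝ)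
    (hx : ∀ i, 0 ≤ x i ∧ x i ≤ 1) :
    MvPolynomial.aeval x (soloInformedAkDen m) = 0 ↔ x = 0 := by
  rw [soloInformed_aeval_akDen]
  constructor
  · intro h
    have h0 : 0 ≤ x 0 := (hx 0).1
    have hp : 0 ≤ x 0 ^ (m + 3) := pow_nonneg h0 _
    have h3 : x 0 ^ (m + 3) = 0 := by nlinarith [sq_nonneg (x 0 - x 1)]
    have hx0 : x 0 = 0 := (pow_eq_zero_iff (by omega)).1 h3
    have h4 : (x 0 - x 1) ^ 2 = 0 := by linarith
    have hx1 : x 1 = 0 := by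
      have h5 : x 0 - x 1 = 0 := (pow_eq_zero_iff two_ne_zero).1 h4
      linarith
    exact funext fun i => by fin_cases i <;> simp [hx0, hx1]
  · rintro rfl
    simp

/-- `Q_m` is positive on the open square. -/
theorem soloInformed_aeval_akDen_pos (m : ℕ) {x : Fin 2 → ℝ} (hx : x ∈ soloInformedOpenCube 2) :
    0 < MvPolynomial.aeval x (soloInformedAkDen m) := by
  rw [soloInformed_aeval_akDen]
  have h0 := (hx 0).1
  positivity

/-! ## The two triangle charts -/

/-- `Q_m(v₀, v₀v₁) = v₀² ((1 − v₁)² + v₀^{m+1})`. [this work] -/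
theorem soloInformed_aeval_akDen_lowerChart (m : ℕ) (v : Fin 2 → ℝ) :
    MvPolynomial.aeval (fun i => ∏ j, v j ^ soloInformedLowerMat i j) (soloInformedAkDen m) =
      v 0 ^ 2 * ((1 - v 1) ^ 2 + v 0 ^ (m + 1)) := by
  simp only [soloInformedAkDen, map_add, map_sub, map_pow, MvPolynomial.aeval_X,
    soloInformed_prod_lowerMat_zero, soloInformed_prod_lowerMat_one]
  ring

/-- `Q_m(u₀u₁, u₁) = u₁² ((1 − u₀)² + u₀^{m+3} u₁^{m+1})`. [this work] -/
theorem soloInformed_aeval_akDen_upperChart (m : ℕ) (v : Fin 2 → ℝ) :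
    MvPolynomial.aeval (fun i => ∏ j, v j ^ soloInformedUpperMat i j) (soloInformedAkDen m) =
      v 1 ^ 2 * ((1 - v 0) ^ 2 + v 0 ^ (m + 3) * v 1 ^ (m + 1)) := by
  simp only [soloInformedAkDen, map_add, map_sub, map_pow, MvPolynomial.aeval_X,
    soloInformed_prod_upperMat_zero, soloInformed_prod_upperMat_one]
  ring

/-- The pulled-back form along the lower chart: `f(v₀, v₀v₁) v₀ = P_low(v) / Q₁(v)`. [this work] -/
theorem soloInformed_ak_lowerChart_form (m : ℕ) (P : MvPolynomial (Fin 2) ℚ) (v : Fin 2 → ℝ)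
    (hv : v ∈ soloInformedOpenCube 2) :
    MvPolynomial.aeval (fun i => ∏ j, v j ^ soloInformedLowerMat i j) P /
        MvPolynomial.aeval (fun i => ∏ j, v j ^ soloInformedLowerMat i j) (soloInformedAkDen m) *
          v 0 =
      MvPolynomial.aeval v (soloInformedChartQuot soloInformedLowerMat P 0) /
        MvPolynomial.aeval v (soloInformedAkLowerDen m) := by
  rw [soloInformed_aeval_akDen_lowerChart,
    soloInformed_aeval_monomialMap_chartQuot_zero soloInformedLowerMat P v,
    soloInformed_aeval_akLowerDen]
  have h0 : v 0 ≠ 0 := (hv 0).1.ne'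
  have hq : (1 - v 1) ^ 2 + v 0 ^ (m + 1) ≠ 0 := by
    have := (hv 0).1
    positivity
  field_simp

/-- The pulled-back form along the upper chart: `f(u₀u₁, u₁) u₁ = P_up(u) / Q₂(u)`. [this work] -/
theorem soloInformed_ak_upperChart_form (m : ℕ) (P : MvPolynomial (Fin 2) ℚ) (v : Fin 2 → ℝ)
    (hv : v ∈ soloInformedOpenCube 2) :
    MvPolynomial.aeval (fun i => ∏ j, v j ^ soloInformedUpperMat i j) P /
        MvPolynomial.aeval (fun i => ∏ j, v j ^ soloInformedUpperMat i j) (soloInformedAkDen m) *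
          v 1 =
      MvPolynomial.aeval v (soloInformedChartQuot soloInformedUpperMat P 0) /
        MvPolynomial.aeval v (soloInformedAkUpperDen m) := by
  rw [soloInformed_aeval_akDen_upperChart,
    soloInformed_aeval_monomialMap_chartQuot_zero soloInformedUpperMat P v,
    soloInformed_aeval_akUpperDen]
  have h0 : v 1 ≠ 0 := (hv 1).1.ne'
  have hq : (1 - v 0) ^ 2 + v 0 ^ (m + 3) * v 1 ^ (m + 1) ≠ 0 := by
    have := (hv 0).1
    have := (hv 1).1
    positivity
  field_simp

/-! ## The vertex reflections of the chart denominators are cube-nondegenerate -/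

/-- `Q₁(x₀, 1 − x₁) = x₀ (x₀^{m+1} + x₁²)`. [this work] -/
theorem soloInformed_vertexReflect_akLowerDen (m : ℕ) :
    soloInformedVertexReflect ({1} : Finset (Fin 2)) (soloInformedAkLowerDen m) =
      MvPolynomial.X 0 * (MvPolynomial.X 0 ^ (m + 1) + MvPolynomial.X 1 ^ 2) := by
  simp only [soloInformedAkLowerDen, map_mul, map_add, map_sub, map_pow, map_one,
    soloInformed_vertexReflect_X, Finset.mem_singleton, if_true,
    show ((0 : Fin 2) = 1) = False from by simp, if_false]
  ring

/-- `Q₂(1 − x₀, x₁) = x₁ (x₀² + x₁^{m+1} (1 − x₀)^{m+3})`. [this work] -/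
theorem soloInformed_vertexReflect_akUpperDen (m : ℕ) :
    soloInformedVertexReflect ({0} : Finset (Fin 2)) (soloInformedAkUpperDen m) =
      MvPolynomial.X 1 * soloInformedAkChartDen m := by
  unfold soloInformedAkChartDen
  simp only [soloInformedAkUpperDen, map_mul, map_add, map_sub, map_pow, map_one,
    soloInformed_vertexReflect_X, Finset.mem_singleton, if_true,
    show ((1 : Fin 2) = 0) = False from by simp, if_false]
  ring

/-- `x₀^{m+1} + x₁²` is cube-nondegenerate (LEMMA DOM with `k = (m+1, 2)`, `R = 0`). [this work] -/
theorem soloInformed_cubeNondegenerate_XPowAddSq (m : ℕ) :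
    SoloInformedCubeNondegenerate
      (MvPolynomial.X 0 ^ (m + 1) + MvPolynomial.X 1 ^ 2 : MvPolynomial (Fin 2) ℚ) := by
  have hS := soloInformed_sum_monomial_fin_two ![m + 1, 2]
  simp only [Matrix.cons_val_zero, Matrix.cons_val_one] at hS
  have h := soloInformed_cubeNondegenerate_of_dominant two_pos ![m + 1, 2]
    (fun i => by fin_cases i <;> simp) (fun _ => (1 : ℚ)) (fun _ => one_pos) 0
    (fun a ha => by simp at ha) fun x hx hx0 => ?_
  · rwa [add_zero, hS] at h
  · rw [add_zero, hS]
    simp only [map_add, map_pow, MvPolynomial.aeval_X]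
    intro h
    have h0 : 0 ≤ x 0 := (hx 0).1
    have hp : 0 ≤ x 0 ^ (m + 1) := pow_nonneg h0 _
    have h1 : x 0 ^ (m + 1) = 0 := by nlinarith [sq_nonneg (x 1)]
    have hx0' : x 0 = 0 := (pow_eq_zero_iff (by omega)).1 h1
    have h2 : x 1 ^ 2 = 0 := by linarith
    have hx1' : x 1 = 0 := (pow_eq_zero_iff two_ne_zero).1 h2
    exact hx0 (funext fun i => by fin_cases i <;> simp [hx0', hx1'])

/-- The reflected upper-chart denominator in the shape of LEMMA DOM (`k = (2, m+1)`, `c = 1`).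
[this work] -/
theorem soloInformed_akChartDen_eq (m : ℕ) :
    (∑ i : Fin 2, MvPolynomial.monomial (Finsupp.single i (![2, m + 1] i))
        ((fun _ : Fin 2 => (1 : ℚ)) i)) + soloInformedAkChartR m = soloInformedAkChartDen m := by
  rw [soloInformed_sum_monomial_fin_two, soloInformedAkChartR, soloInformedAkChartDen]
  simp only [Matrix.cons_val_zero, Matrix.cons_val_one]
  ring

/-- The reflected upper-chart denominator vanishes on the closed square only at the origin.
[this work] -/
theorem soloInformed_akChartDen_ne_zero (m : ℕ) (x : Fin 2 → ℝ) (hx : ∀ i, 0 ≤ x i ∧ x i ≤ 1)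
    (hx0 : x ≠ 0) : MvPolynomial.aeval x (soloInformedAkChartDen m) ≠ 0 := by
  rw [soloInformed_aeval_akChartDen]
  intro h
  have h0 : 0 ≤ x 0 := (hx 0).1
  have h1 : 0 ≤ x 1 := (hx 1).1
  have h2 : 0 ≤ 1 - x 0 := sub_nonneg.2 (hx 0).2
  have h3 : 0 ≤ x 1 ^ (m + 1) * (1 - x 0) ^ (m + 3) :=
    mul_nonneg (pow_nonneg h1 _) (pow_nonneg h2 _)
  have h4 : x 0 ^ 2 = 0 := by nlinarith [sq_nonneg (x 0)]
  have hx0' : x 0 = 0 := (pow_eq_zero_iff two_ne_zero).1 h4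
  have h5 : x 1 ^ (m + 1) * (1 - x 0) ^ (m + 3) = 0 := by linarith
  rcases mul_eq_zero.1 h5 with h6 | h6
  · have hx1' : x 1 = 0 := (pow_eq_zero_iff (by omega)).1 h6
    exact hx0 (funext fun i => by fin_cases i <;> simp [hx0', hx1'])
  · have h7 : (1 : ℝ) - x 0 = 0 := (pow_eq_zero_iff (by omega)).1 h6
    rw [hx0'] at h7
    norm_num at h7

/-- **The reflected upper-chart denominator `x₀² + x₁^{m+1} (1 − x₀)^{m+3}` is
cube-nondegenerate** (LEMMA DOM: every monomial of the remainder `x₁^{m+1} ((1 − x₀)^{m+3} − 1)`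
is strictly divisible by `x₁^{m+1}`, since `(1 − x₀)^{m+3} − 1` has no constant term).
[this work] -/
theorem soloInformed_cubeNondegenerate_akChartDen (m : ℕ) :
    SoloInformedCubeNondegenerate (soloInformedAkChartDen m) := by
  rw [← soloInformed_akChartDen_eq]
  refine soloInformed_cubeNondegenerate_of_dominant two_pos ![2, m + 1]
    (fun i => by fin_cases i <;> simp) (fun _ => (1 : ℚ)) (fun _ => one_pos)
    (soloInformedAkChartR m) (fun a ha => ⟨1, ?_⟩) fun x hx hx0 => ?_
  · simp only [Matrix.cons_val_one, Matrix.cons_val_zero]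
    have hT0 : MvPolynomial.coeff 0
        ((1 - MvPolynomial.X 0) ^ (m + 3) - 1 : MvPolynomial (Fin 2) ℚ) = 0 := by
      rw [← MvPolynomial.constantCoeff_eq]
      simp
    have ha' := MvPolynomial.mem_support_iff.1 ha
    rw [soloInformedAkChartR, MvPolynomial.X_pow_eq_monomial, MvPolynomial.coeff_monomial_mul']
      at ha'
    split_ifs at ha' with hle
    · refine ⟨hle, fun heq => ha' ?_⟩
      rw [← heq, tsub_self, hT0, mul_zero]
    · exact absurd rfl ha'
  · rw [soloInformed_akChartDen_eq]
    exact soloInformed_akChartDen_ne_zero m x hx hx0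

/-- The vertex reflection `x₁ ↦ 1 − x₁` of `Q₁` is cube-nondegenerate. [this work] -/
theorem soloInformed_cubeNondegenerate_vertexReflect_akLowerDen (m : ℕ) :
    SoloInformedCubeNondegenerate
      (soloInformedVertexReflect ({1} : Finset (Fin 2)) (soloInformedAkLowerDen m)) := by
  rw [soloInformed_vertexReflect_akLowerDen]
  exact soloInformed_cubeNondegenerate_mul (soloInformed_cubeNondegenerate_X 0)
    (soloInformed_cubeNondegenerate_XPowAddSq m)

/-- The vertex reflection `x₀ ↦ 1 − x₀` of `Q₂` is cube-nondegenerate. [this work] -/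
theorem soloInformed_cubeNondegenerate_vertexReflect_akUpperDen (m : ℕ) :
    SoloInformedCubeNondegenerate
      (soloInformedVertexReflect ({0} : Finset (Fin 2)) (soloInformedAkUpperDen m)) := by
  rw [soloInformed_vertexReflect_akUpperDen]
  exact soloInformed_cubeNondegenerate_mul (soloInformed_cubeNondegenerate_X 1)
    (soloInformed_cubeNondegenerate_akChartDen m)

/-! ## THEOREM A_k -/

/-- **THEOREM A_k.**  For every `m : ℕ` (`k = m + 3 ≥ 3`), every numerator `P ∈ ℚ[x₀, x₁]` and
every `IntegralRep` `r = [σ, f]` with `(0,1)² ⊆ σ ⊆ [0,1]²` and `f = P / ((x₀ − x₁)² + x₀^{m+3})`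
on the open square, `of r` is presentable: modulo `KZ.relations` it is a `ℤ`-combination of cube
integrals of real parts of germs holomorphic near closed cubes (the cube crux with `k = 1`),
although `Q_m` and all its vertex reflections are cube-degenerate.  One diagonal blow-up and
one vertex move reduce the whole `A`-family to THEOREM ND-GEN. [this work] -/
theorem soloInformed_presentable_ak (m : ℕ) (P : MvPolynomial (Fin 2) ℚ) (r : IntegralRep 2)
    (hO : soloInformedOpenCube 2 ⊆ r.domain) (hC : r.domain ⊆ soloInformedCube 2)
    (hri : EqOn r.integrand
      (fun x => MvPolynomial.aeval x P / MvPolynomial.aeval x (soloInformedAkDen m))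
      (soloInformedOpenCube 2)) :
    of r ∈ soloInformedPresentable :=
  soloInformed_presentable_of_diagonalCharts_vertex P (soloInformedAkDen m)
    (soloInformedChartQuot soloInformedLowerMat P 0) (soloInformedAkLowerDen m)
    (soloInformedChartQuot soloInformedUpperMat P 0) (soloInformedAkUpperDen m) {1} {0}
    (soloInformed_cubeNondegenerate_vertexReflect_akLowerDen m)
    (soloInformed_cubeNondegenerate_vertexReflect_akUpperDen m)
    (soloInformed_ak_lowerChart_form m P) (soloInformed_ak_upperChart_form m P) r hO hC hri

/-- THEOREM A_k on the closed square, in the output format of the cube crux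
`SoloInformedAyoubCubeResolutionCube` (`k = 1`). [this work] -/
theorem soloInformed_cubeResolution_ak (m : ℕ) (P : MvPolynomial (Fin 2) ℚ) (r : IntegralRep 2)
    (hr : r.domain = soloInformedCube 2)
    (hri : EqOn r.integrand
      (fun x => MvPolynomial.aeval x P / MvPolynomial.aeval x (soloInformedAkDen m))
      (soloInformedOpenCube 2)) :
    ∃ (k : ℕ) (_ : k ≠ 0) (m' : ℕ) (d : Fin m' → ℕ) (G : ∀ j, SoloInformedCubeGerm (d j))
      (c : Fin m' → ℤ) (ρ : ∀ j, IntegralRep (d j)),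
      (∀ j, (ρ j).domain = soloInformedCube (d j)) ∧
      (∀ j, EqOn (ρ j).integrand (fun x => ((G j).g (soloInformedToC (d j) x)).re)
        (soloInformedCube (d j))) ∧
      k • of r - ∑ j, c j • of (ρ j) ∈ relations :=
  soloInformed_exists_fin_of_presentable
    (soloInformed_presentable_ak m P r (hr ▸ soloInformedOpenCube_subset_cube 2) hr.le hri)

/-! ## Hypothesis-free instances: `[(0,1)², x₀^{m+3} / ((x₀ − x₁)² + x₀^{m+3})]` -/

/-- `x₀^{m+3} / Q_m` is integrable on the open square (measurable and bounded by `1`).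
[this work] -/
theorem soloInformed_integrableOn_ak (m : ℕ) :
    IntegrableOn (fun x : Fin 2 → ℝ =>
      MvPolynomial.aeval x (MvPolynomial.X 0 ^ (m + 3) : MvPolynomial (Fin 2) ℚ) /
        MvPolynomial.aeval x (soloInformedAkDen m)) (soloInformedOpenCube 2) := by
  have hf : (fun x : Fin 2 → ℝ =>
      MvPolynomial.aeval x (MvPolynomial.X 0 ^ (m + 3) : MvPolynomial (Fin 2) ℚ) /
        MvPolynomial.aeval x (soloInformedAkDen m)) =
      fun x => x 0 ^ (m + 3) / ((x 0 - x 1) ^ 2 + x 0 ^ (m + 3)) := by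
    funext x
    rw [soloInformed_aeval_akDen, map_pow, MvPolynomial.aeval_X]
  rw [hf]
  have hmeas : Measurable fun x : Fin 2 → ℝ => x 0 ^ (m + 3) / ((x 0 - x 1) ^ 2 + x 0 ^ (m + 3)) :=
    ((measurable_pi_apply 0).pow_const (m + 3)).div
      ((((measurable_pi_apply 0).sub (measurable_pi_apply 1)).pow_const 2).add
        ((measurable_pi_apply 0).pow_const (m + 3)))
  have hfin : volume (soloInformedOpenCube 2) ≠ ⊤ := by
    refine (lt_of_le_of_lt (measure_mono (soloInformedOpenCube_subset_cube 2)) ?_).ne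
    rw [soloInformedCube_eq_Icc]
    exact measure_Icc_lt_top
  have hmeasO : MeasurableSet (soloInformedOpenCube 2) := by
    rw [soloInformedOpenCube_eq_pi]; exact MeasurableSet.univ_pi fun _ => measurableSet_Ioo
  refine Measure.integrableOn_of_bounded (M := 1) hfin hmeas.aestronglyMeasurable
    ((ae_restrict_iff' hmeasO).2 (Filter.Eventually.of_forall fun x hx => ?_))
  have h0 : 0 < x 0 := (hx 0).1
  have hden : 0 < (x 0 - x 1) ^ 2 + x 0 ^ (m + 3) := by positivity
  rw [Real.norm_eq_abs, abs_of_nonneg (div_nonneg (pow_nonneg h0.le _) hden.le)]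
  exact div_le_one_of_le₀ (le_add_of_nonneg_left (sq_nonneg _)) hden.le

/-- The integral `[(0,1)², x₀^{m+3} / ((x₀ − x₁)² + x₀^{m+3})]` as an `IntegralRep` in KZ's
literal rational shape. [this work] -/
def soloInformedAkRep (m : ℕ) : IntegralRep 2 :=
  IntegralRep.ofRational (soloInformedOpenCube 2) (MvPolynomial.X 0 ^ (m + 3))
    (soloInformedAkDen m) (isSemialgebraic_soloInformedOpenCube 2)
    (fun _ hx => (soloInformed_aeval_akDen_pos m hx).ne') (soloInformed_integrableOn_ak m)

/-- **The `A`-family integrals are presentable** (no hypotheses): for every `m`,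
`of [(0,1)², x₀^{m+3}/((x₀ − x₁)² + x₀^{m+3})]` is, modulo `KZ.relations`, a `ℤ`-combination of
cube integrals of real parts of germs holomorphic near closed cubes. [this work] -/
theorem soloInformed_presentable_akRep (m : ℕ) :
    of (soloInformedAkRep m) ∈ soloInformedPresentable :=
  soloInformed_presentable_ak m (MvPolynomial.X 0 ^ (m + 3)) (soloInformedAkRep m) subset_rfl
    (soloInformedOpenCube_subset_cube 2) fun _ _ => rfl

end Summit.KontsevichZagierPeriods.KontsevichZagierPeriods.Theorems
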